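import Summits.CriticalPhenomena.PercolationContinuityZ3.Theorems.PercNearOneGluingNoHeavyLowerTailSunflowerPartitionReduction
import Summits.CriticalPhenomena.PercolationContinuityZ3.Theorems.PercNearOneGluingNoHeavyLowerTailSunflowerPromotion
import HarnessLib
import HarnessLib.Audit

/-!
# `NoHeavyLowerTail` (crux stmt-CriticalPhenomena-4575), abstract sunflower cubic: the MAIN REDUCTION — the three-up-set inequality (R2)
# implies the partition lemma for every petal-founded sunflower

Support file (seat `prim-ineq-prove-1` gen 25; `--supports stmt-CriticalPhenomena-4575`; companion of `…SunflowerAntipodalGladkov`,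
`…SunflowerPartitionLemma`, `…SunflowerPartitionReduction`).  Memo: run/shared/lean/prim/prim-ineq-prove-1/ABSTRACT-SUNFLOWER-CUBIC-prove1-g25.md §8.

* `Sunflower.petal`, `Sunflower.upcl`, `Sunflower.forced` (θ-pullback of the petal closures `↑C_i`), `Sunflower.demote`.
* `Sunflower.forced_ZH_le_ZH` — **(R1-founded)**: `ZH (forced F) ≤ ZH F` for every PETAL-FOUNDED sunflower (every kernel set contains a petal
  set — all percolation instances): induction on `#(A ∖ A_f)`; demote an unforced kernel set `K` of minimal cardinality to its petal (`demote`,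
  legal by minimality), apply the induction hypothesis, and promote `K` back (`ZH_le_ZH_promote`, petal-promotion monotonicity ⟸ antipodal Gladkov).
* `PartitionLemmaHFounded` (typed, OPEN) and **`partitionLemmaHFounded_of_threeUpset : ThreeUpsetPartitionIneq → PartitionLemmaHFounded`**.
  With the cloning reduction (memo §3, not formalised) this makes `γ`, `G₄`, `H_{q+t}`, `AG⁺`, `T_inc`, `3PT-LB` on every finite weighted graph
  consequences of the single counting inequality (R2) about three arbitrary up-sets.
-/

namespace Summit.CriticalPhenomena.PercolationContinuityZ3.Theorems.SunflowerPartition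

open Finset

variable {α : Type*} [Fintype α] [DecidableEq α]

/-! ## Petal-founded sunflowers: `ZH F ≥ ZH (forced F)` by iterated petal promotion (memo §8, (R1-founded)) -/

namespace Sunflower

variable (F : Sunflower α)

omit [Fintype α] in
/-- `A ⊆ V i` for every `i`. [this work] -/
theorem A_subset_V (i : Fin 3) : F.A ⊆ F.V i := by
  intro S hS
  unfold A at hS
  fin_cases i
  · exact (mem_inter.1 hS).1
  · exact (mem_inter.1 hS).2
  · have h := F.inter_eq 0 2 (by decide)
    have : S ∈ F.V 0 ∩ F.V 2 := by rw [h]; exact hS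
    exact (mem_inter.1 this).2

/-- The petal families `C_i = V i ∖ A`. [this work] -/
def petal (i : Fin 3) : Finset (Finset α) := F.V i \ F.A

/-- Up-closure of a family of sets. [this work] -/
def upcl (𝒞 : Finset (Finset α)) : Finset (Finset α) := Finset.univ.filter fun S => ∃ P ∈ 𝒞, P ⊆ S

omit [DecidableEq α] in
/-- Membership in the up-closure. [this work] -/
theorem mem_upcl [DecidableEq α] {𝒞 : Finset (Finset α)} {S : Finset α} : S ∈ upcl 𝒞 ↔ ∃ P ∈ 𝒞, P ⊆ S := by
  unfold upcl; simp

omit [DecidableEq α] in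
/-- The up-closure is an up-set. [this work] -/
theorem upcl_upper [DecidableEq α] (𝒞 : Finset (Finset α)) : IsUpperSet (upcl 𝒞 : Set (Finset α)) := by
  intro S T hST hS
  rw [Finset.mem_coe, mem_upcl] at hS ⊢
  obtain ⟨P, hP, hPS⟩ := hS
  exact ⟨P, hP, hPS.trans hST⟩

/-- **The forced sunflower** `φ_f`: θ-pullback of the petal closures `↑C_i`. [this work] -/
def forced : Sunflower α := ofUpsets (fun i => upcl (F.petal i)) (fun _ => upcl_upper _)

/-! **Petal-founded** sunflowers: every kernel set contains a petal set, `∀ S ∈ F.A, ∃ i, ∃ P ∈ F.petal i, P ⊆ S` (true for all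
percolation instances; written out in full below, no `Prop`-valued definition). -/

/-- `V i = A ∪ ↑C_i`. [this work] -/
theorem V_eq_A_union_upcl (i : Fin 3) : F.V i = F.A ∪ upcl (F.petal i) := by
  ext S
  rw [mem_union, mem_upcl]
  constructor
  · intro hS
    by_cases hA : S ∈ F.A
    · exact Or.inl hA
    · exact Or.inr ⟨S, by unfold petal; exact mem_sdiff.2 ⟨hS, hA⟩, subset_rfl⟩
  · rintro (hA | ⟨P, hP, hPS⟩)
    · exact F.A_subset_V i hA
    · unfold petal at hP
      exact F.upper i hPS (mem_sdiff.1 hP).1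

/-- The forced kernel. [this work] -/
theorem forced_A : F.forced.A = twoOf (fun i => upcl (F.petal i)) := by
  show (upcl (F.petal 0) ∪ twoOf (fun i => upcl (F.petal i))) ∩ (upcl (F.petal 1) ∪ twoOf (fun i => upcl (F.petal i)))
      = twoOf (fun i => upcl (F.petal i))
  ext S
  rw [mem_inter, mem_union, mem_union]
  constructor
  · rintro ⟨h0 | h0, h1 | h1⟩
    · exact mem_twoOf.2 (Or.inl ⟨h0, h1⟩)
    · exact h1
    · exact h0
    · exact h0
  · intro h; exact ⟨Or.inr h, Or.inr h⟩

/-- The forced kernel is contained in the kernel. [this work] -/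
theorem forced_A_subset : F.forced.A ⊆ F.A := by
  intro S hS
  rw [forced_A, mem_twoOf] at hS
  have key : ∀ i j : Fin 3, i ≠ j → S ∈ upcl (F.petal i) → S ∈ upcl (F.petal j) → S ∈ F.A := by
    intro i j hij hi hj
    have h1 : S ∈ F.V i := by rw [V_eq_A_union_upcl]; exact mem_union_right _ hi
    have h2 : S ∈ F.V j := by rw [V_eq_A_union_upcl]; exact mem_union_right _ hj
    exact F.mem_A_of_mem_mem hij h1 h2
  rcases hS with ⟨h1, h2⟩ | ⟨h1, h2⟩ | ⟨h1, h2⟩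
  · exact key 0 1 (by decide) h1 h2
  · exact key 0 2 (by decide) h1 h2
  · exact key 1 2 (by decide) h1 h2

/-- The forced kernel is an up-set. [this work] -/
theorem forced_A_upper : IsUpperSet (F.forced.A : Set (Finset α)) := by
  rw [forced_A]; exact twoOf_upper fun i => upcl_upper _

omit [Fintype α] in
/-- `ZH` only depends on the three up-sets. [this work] -/
theorem lab_congr [Fintype α] {F G : Sunflower α} (h : ∀ i, F.V i = G.V i) (S : Finset α) : F.lab S = G.lab S := by
  unfold lab A; simp only [h]

/-- `ZH` only depends on the three up-sets. [this work] -/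
theorem ZH_congr {F G : Sunflower α} (h : ∀ i, F.V i = G.V i) : F.ZH = G.ZH := by
  unfold ZH; exact sum_congr rfl fun q _ => by rw [lab_congr h, lab_congr h, lab_congr h]

/-- If the kernel is already forced, `F` and `forced F` have the same up-sets. [this work] -/
theorem V_eq_forced_of_A_subset (hA : F.A ⊆ F.forced.A) (i : Fin 3) : F.forced.V i = F.V i := by
  have hAeq : F.A = F.forced.A := Subset.antisymm hA F.forced_A_subset
  rw [F.V_eq_A_union_upcl i, hAeq, forced_A]
  show upcl (F.petal i) ∪ twoOf (fun i => upcl (F.petal i)) = twoOf (fun i => upcl (F.petal i)) ∪ upcl (F.petal i)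
  exact union_comm _ _

/-! ### One demotion step -/

omit [Fintype α] in
/-- Pairwise intersections after demoting `K` from all up-sets except `V i₀`. [this work] -/
theorem demote_inter_aux (K : Finset α) (i₀ i j : Fin 3) (hij : i ≠ j) :
    ((if i = i₀ then F.V i else (F.V i).erase K) ∩ (if j = i₀ then F.V j else (F.V j).erase K)) = (F.A).erase K := by
  have h := F.inter_eq i j hij
  have hA : ∀ S, (S ∈ F.V i ∧ S ∈ F.V j) ↔ S ∈ F.A := by
    intro S; rw [← mem_inter, h]; rfl
  ext S
  rw [mem_erase, ← hA S, mem_inter]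
  by_cases hi : i = i₀
  · have hj : j ≠ i₀ := fun hj => hij (hi.trans hj.symm)
    rw [if_pos hi, if_neg hj, mem_erase, hi]
    tauto
  · by_cases hj : j = i₀
    · rw [if_neg hi, if_pos hj, mem_erase, hj]
      tauto
    · rw [if_neg hi, if_neg hj, mem_erase, mem_erase]
      tauto

omit [Fintype α] in
/-- Demote the kernel set `K` to the petal `i₀`: remove `K` from the other two up-sets. [this work] -/
def demote (K : Finset α) (i₀ : Fin 3)
    (hup : ∀ i, i ≠ i₀ → ∀ S ∈ F.V i, S ≠ K → ∀ T, S ⊆ T → T ≠ K) : Sunflower α where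
  V := fun i => if i = i₀ then F.V i else (F.V i).erase K
  upper := by
    intro i S T hST hS
    rw [Finset.mem_coe] at hS ⊢
    by_cases hi : i = i₀
    · simp only [hi, if_true] at hS ⊢
      exact F.upper i₀ hST hS
    · simp only [hi, if_false] at hS ⊢
      rw [mem_erase] at hS ⊢
      exact ⟨hup i hi S hS.2 hS.1 T hST, F.upper i hST hS.2⟩
  inter_eq := by
    intro i j hij
    rw [F.demote_inter_aux K i₀ i j hij, F.demote_inter_aux K i₀ 0 1 (by decide)]

omit [Fintype α] in
/-- Kernel of the demoted sunflower. [this work] -/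
theorem demote_A (K : Finset α) (i₀ : Fin 3) (hup) : (F.demote K i₀ hup).A = (F.A).erase K :=
  F.demote_inter_aux K i₀ 0 1 (by decide)

omit [Fintype α] in
/-- Promoting back the demoted set recovers the original up-sets. [this work] -/
theorem promote_demote_V (K : Finset α) (i₀ : Fin 3) (hup) (hKV : ∀ i, K ∈ F.V i) (hsup) (i : Fin 3) :
    ((F.demote K i₀ hup).promote K hsup).V i = F.V i := by
  show insert K ((F.demote K i₀ hup).V i) = F.V i
  unfold demote
  by_cases hi : i = i₀
  · simp only [hi, if_true]; exact insert_eq_of_mem (hKV i₀)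
  · simp only [hi, if_false]; exact insert_erase (hKV i)

/-- **(R1-founded)** (this work): for a petal-founded sunflower, `ZH (forced F) ≤ ZH F` — promote the unforced kernel sets one at a time in
order of decreasing… (here: demote them one at a time in order of INCREASING cardinality and use `ZH_le_ZH_promote`). [this work] -/
theorem forced_ZH_le : ∀ (n : ℕ) (F : Sunflower α), (∀ S ∈ F.A, ∃ i : Fin 3, ∃ P ∈ F.petal i, P ⊆ S) → #(F.A \ F.forced.A) = n → F.forced.ZH ≤ F.ZH := by
  intro n
  induction n with
  | zero =>
    intro F _ hn
    have hA : F.A ⊆ F.forced.A := by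
      intro S hS; by_contra h
      have : S ∈ F.A \ F.forced.A := mem_sdiff.2 ⟨hS, h⟩
      rw [card_eq_zero.1 hn] at this; simp at this
    exact le_of_eq (ZH_congr (F.V_eq_forced_of_A_subset hA))
  | succ n ih =>
    intro F hF hn
    -- pick K ∈ A \ A_f of minimal cardinality
    have hne : (F.A \ F.forced.A).Nonempty := by rw [← card_pos, hn]; exact Nat.succ_pos n
    obtain ⟨K, hKmem, hKmin⟩ := exists_min_image (F.A \ F.forced.A) (fun S => #S) hne
    have hKA : K ∈ F.A := (mem_sdiff.1 hKmem).1
    have hKnf : K ∉ F.forced.A := (mem_sdiff.1 hKmem).2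
    -- K contains a petal set of some kind i₀ (founded), hence lies in exactly one petal closure
    obtain ⟨i₀, P, hP, hPK⟩ := hF K hKA
    have hKup : K ∈ upcl (F.petal i₀) := mem_upcl.2 ⟨P, hP, hPK⟩
    have hKnot : ∀ j, j ≠ i₀ → K ∉ upcl (F.petal j) := by
      intro j hj hKj
      apply hKnf
      rw [forced_A, mem_twoOf]
      fin_cases i₀ <;> fin_cases j <;> simp_all
    -- minimality consequences: a proper subset of K lying in A lies in the forced kernel
    have hsubA : ∀ S, S ∈ F.A → S ⊆ K → S ≠ K → S ∈ F.forced.A := by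
      intro S hS hSK hSne
      by_contra h
      have hlt : #S < #K := card_lt_card (lt_of_le_of_ne hSK hSne)
      have := hKmin S (mem_sdiff.2 ⟨hS, h⟩)
      omega
    -- the demotion is legal
    have hup : ∀ i, i ≠ i₀ → ∀ S ∈ F.V i, S ≠ K → ∀ T, S ⊆ T → T ≠ K := by
      intro i hi S hS hSne T hST hTK
      subst hTK
      rw [V_eq_A_union_upcl, mem_union] at hS
      rcases hS with hS | hS
      · -- S ∈ A, S ⊊ K ⇒ S ∈ A_f ⇒ K ∈ A_f
        exact hKnf (F.forced_A_upper hST (hsubA S hS hST hSne))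
      · -- S ∈ ↑C_i with i ≠ i₀ ⇒ K ∈ ↑C_i
        exact hKnot i hi (upcl_upper _ hST hS)
    set G := F.demote K i₀ hup with hG
    have hGA : G.A = (F.A).erase K := F.demote_A K i₀ hup
    -- K is nonempty
    have hKne : K.Nonempty := by
      rw [nonempty_iff_ne_empty]; rintro rfl
      have hP0 : P = ∅ := subset_empty.1 hPK
      subst hP0
      unfold petal at hP
      exact (mem_sdiff.1 hP).2 hKA
    -- K is a petal-i₀ set of G
    have hKV : ∀ i, K ∈ F.V i := fun i => F.A_subset_V i hKA
    have hGlab : G.lab K = 1 ∨ G.lab K = 2 ∨ G.lab K = 3 := by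
      have hKGA : K ∉ G.A := by rw [hGA]; exact Finset.notMem_erase K F.A
      have hGV : ∀ i, (K ∈ G.V i ↔ i = i₀) := by
        intro i; show (K ∈ (if i = i₀ then F.V i else (F.V i).erase K)) ↔ _
        by_cases hi : i = i₀
        · simp only [hi, if_true, iff_true]; exact hKV i₀
        · simp only [hi, if_false, mem_erase, ne_eq, not_true_eq_false, false_and]
      unfold lab
      rw [if_neg hKGA]
      fin_cases i₀
      · left; rw [if_pos ((hGV 0).2 rfl)]
      · right; left; rw [if_neg (fun h => by have := (hGV 0).1 h; exact absurd this (by decide)), if_pos ((hGV 1).2 rfl)]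
      · right; right
        rw [if_neg (fun h => by have := (hGV 0).1 h; exact absurd this (by decide)),
          if_neg (fun h => by have := (hGV 1).1 h; exact absurd this (by decide)), if_pos ((hGV 2).2 rfl)]
    -- proper supersets of K are in G's kernel
    have hsup : ∀ T : Finset α, K ⊂ T → T ∈ G.A := by
      intro T hKT
      rw [hGA, mem_erase]
      exact ⟨(ne_of_lt hKT).symm, F.mem_A_of_subset hKT.le hKA⟩
    -- G is petal-founded
    have hGF : ∀ S ∈ G.A, ∃ i : Fin 3, ∃ P ∈ G.petal i, P ⊆ S := by
      intro S hS
      rw [hGA, mem_erase] at hS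
      obtain ⟨i, Q, hQ, hQS⟩ := hF S hS.2
      refine ⟨i, Q, ?_, hQS⟩
      unfold petal at hQ ⊢
      rw [mem_sdiff] at hQ ⊢
      refine ⟨?_, by rw [hGA, mem_erase]; exact fun h => hQ.2 h.2⟩
      show Q ∈ (if i = i₀ then F.V i else (F.V i).erase K)
      by_cases hi : i = i₀
      · simp only [hi, if_true]; exact hi ▸ hQ.1
      · simp only [hi, if_false, mem_erase]
        refine ⟨fun h => ?_, hQ.1⟩
        subst h
        exact hKnot i hi (mem_upcl.2 ⟨Q, by unfold petal; exact mem_sdiff.2 hQ, subset_rfl⟩)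
    -- the petal closures of G equal those of F, hence forced G = forced F (as up-sets)
    have hpet : ∀ i, upcl (G.petal i) = upcl (F.petal i) := by
      intro i
      ext S
      rw [mem_upcl, mem_upcl]
      constructor
      · rintro ⟨Q, hQ, hQS⟩
        unfold petal at hQ
        rw [mem_sdiff, hGA, mem_erase] at hQ
        have hQV : Q ∈ (if i = i₀ then F.V i else (F.V i).erase K) := hQ.1
        by_cases hQK : Q = K
        · subst hQK
          by_cases hi : i = i₀
          · subst hi; obtain ⟨P', hP', hP'Q⟩ := mem_upcl.1 hKup; exact ⟨P', hP', hP'Q.trans hQS⟩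
          · simp only [hi, if_false, mem_erase, ne_eq, not_true_eq_false, false_and] at hQV
        · have hQF : Q ∈ F.V i := by
            by_cases hi : i = i₀
            · simp only [hi, if_true] at hQV; exact hi ▸ hQV
            · simp only [hi, if_false, mem_erase] at hQV; exact hQV.2
          have hQnA : Q ∉ F.A := fun h => hQ.2 ⟨hQK, h⟩
          exact ⟨Q, by unfold petal; exact mem_sdiff.2 ⟨hQF, hQnA⟩, hQS⟩
      · rintro ⟨Q, hQ, hQS⟩
        unfold petal at hQ; rw [mem_sdiff] at hQ
        refine ⟨Q, ?_, hQS⟩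
        unfold petal; rw [mem_sdiff, hGA, mem_erase]
        refine ⟨?_, fun h => hQ.2 h.2⟩
        show Q ∈ (if i = i₀ then F.V i else (F.V i).erase K)
        by_cases hi : i = i₀
        · simp only [hi, if_true]; exact hi ▸ hQ.1
        · simp only [hi, if_false, mem_erase]
          exact ⟨fun h => by subst h; exact hQ.2 hKA, hQ.1⟩
    have hforcedV : ∀ i, G.forced.V i = F.forced.V i := by
      intro i
      show upcl (G.petal i) ∪ twoOf (fun j => upcl (G.petal j)) = upcl (F.petal i) ∪ twoOf (fun j => upcl (F.petal j))
      have : (fun j => upcl (G.petal j)) = (fun j => upcl (F.petal j)) := funext hpet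
      rw [hpet i, this]
    have hforcedA : G.forced.A = F.forced.A := by
      unfold A; rw [hforcedV 0, hforcedV 1]
    -- measure
    have hcard : #(G.A \ G.forced.A) = n := by
      rw [hGA, hforcedA]
      have : (F.A).erase K \ F.forced.A = (F.A \ F.forced.A).erase K := by
        ext S; simp only [mem_sdiff, mem_erase]; tauto
      rw [this, card_erase_of_mem hKmem, hn]; rfl
    -- conclude
    have ih' := ih G hGF hcard
    have hprom : G.ZH ≤ (G.promote K hsup).ZH := G.ZH_le_ZH_promote K hsup hKne hGlab
    have hback : (G.promote K hsup).ZH = F.ZH := ZH_congr (F.promote_demote_V K i₀ hup hKV hsup)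
    calc F.forced.ZH = G.forced.ZH := ZH_congr fun i => (hforcedV i).symm
      _ ≤ G.ZH := ih'
      _ ≤ (G.promote K hsup).ZH := hprom
      _ = F.ZH := hback

/-- **(R1-founded), packaged**: `ZH (forced F) ≤ ZH F` for every petal-founded sunflower. [this work] -/
theorem forced_ZH_le_ZH (hF : (∀ S ∈ F.A, ∃ i : Fin 3, ∃ P ∈ F.petal i, P ⊆ S)) : F.forced.ZH ≤ F.ZH :=
  forced_ZH_le _ F hF rfl

end Sunflower

/-- The partition lemma restricted to PETAL-FOUNDED sunflowers (every kernel set contains a petal set — all percolation instances).  OPEN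
(implied by `ThreeUpsetPartitionIneq`, below; implies the law-level `H`-row for petal-founded maps by the cloning reduction, memo §3).
An obligation, never a fact. [status: open] -/
@[conjecture] def PartitionLemmaHFounded : Prop :=
  ∀ (α : Type) [Fintype α] [DecidableEq α] (F : Sunflower α), (∀ S ∈ F.A, ∃ i : Fin 3, ∃ P ∈ F.petal i, P ⊆ S) → 0 ≤ F.ZH

/-- **MAIN REDUCTION** (this work): the three-up-set inequality (R2) implies the partition lemma for every petal-founded sunflower —
`0 ≤ ZH (forced F) ≤ ZH F`, the first inequality being (R2) for the petal closures. [this work] -/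
theorem partitionLemmaHFounded_of_threeUpset (h : ThreeUpsetPartitionIneq) : PartitionLemmaHFounded := by
  intro α _ _ F hF
  exact le_trans (h α (fun i => Sunflower.upcl (F.petal i)) fun i => Sunflower.upcl_upper _) (F.forced_ZH_le_ZH hF)

end Summit.CriticalPhenomena.PercolationContinuityZ3.Theorems.SunflowerPartition
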